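import Summits.QuantumFields.YangMills.Theorems.UnitScaleTiltProp7PinnedSkewSplitOpt
import Summits.QuantumFields.YangMills.Theorems.UnitScaleTiltProp7RelPlaqVsCovCurl
import HarnessLib

/-!
# Route `UnitScaleTilt`, crux K1 «MinimiserStabilityRegPr» (stmt-QuantumFields-19200), line «route-R» — the N8 → (ii′) junction for the PINNED representative at the FLAT
# background, file F6: `(1 − s²∕2 − 24576·C₁·ℓ²s²)·Σ_b‖W(b) − 1‖² ≤ 4·C₁·ℓ²·Σ_p‖W(∂p) − 1‖² + 28ℓ·Σ_c|Q^{(k)}(W − 1)(c)|²_F`, `ℓ = L^{K−n}`, NO centre debit,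
# NO structure rows displayed — the only displayed datum is the averaging source `Q^{(k)}(W − 1)` (M10(b))

Cell `ym3-torus`, D-0154 (3c) twin-width seat `ym-routeR-w1` (gen 0); `--supports stmt-QuantumFields-19200 --as helper`; THEOREMS ONLY (0 `def`, 0 `sorry`).
YM₃ on T³ is a ladder rung (R3), not the Clay problem; nothing here claims the stub, the crux, d = 4 or the mass gap.

WHY (numbers).  F5 (✓ p607936 `Prop7PinnedSkewSplitOpt.sum_normSq_le_of_pinnedOpt_flat_T3`) bounds the Frobenius mass of `Y = W − 1` at the pinned `ℓ²`-optimum by the flat curl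
energy and the averaging source, with no divergence term; brick (c) (✓ p605008 `Prop7RelPlaqVsCovCurl.sum_hs_curl_le_relPlaq_T3`) turns the Hilbert–Schmidt curl energy at a
background `U₀` into `4·Σ_p‖R_p − 1‖² + (24576s² + 768a²)·Σ_b‖Y_b‖²` through SQUARES (k-uniform).  At `U₀ ≡ 1` the covariant curl IS the lattice curl (`curl_eq_curl_of_bg_one`,
`a = 0`), the operator mass is below the Frobenius mass, and the two compose to the (ii′)-shape of route-R's growth row for the registered (pinned) representative — with the
rate `(1 − ε₂²∕2 − 24576·C₁·ε₂²)·ℓ⁻²` at `s = ε₂ℓ⁻¹`, uniformly in `k = K − n` and in the volume.  The centre debit `ζ_C` of the covariant-engine branch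
(✓ `Prop7PointLandauBudget.sum_hs_divB_le_of_pinnedOpt`) does not arise: the Hodge route (N1–N7) never charges the divergence.

WHAT IS PROVED (sorry-free, no definition; `SU(2)`, `d = 3` carrier `Site (F.P K) 0`; the flat background is any `U₀` with `∀ b, U₀ b = 1`):
* §1 `plaqHol_eq_one_of_bg_one`, `curl_eq_curl_of_bg_one` (p483802's covariant curl at `U₀ ≡ 1` = `LatticeFieldCalculus.curl 1`), `hs_curl_eq_sum_normSq_curl_of_bg_one`
  (the Hilbert–Schmidt curl sum of brick (c) at `U₀ ≡ 1` = the Frobenius flat curl energy of F1∕F5), `sum_norm_sq_le_sum_normSq` (operator mass ≤ Frobenius mass).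
* §2 ★★ `relPoincare_pinnedOpt_flat_T3` — the title inequality.

HONEST SCOPE.  Flat background only; the `Q`-defect source is displayed (its `O(Y²)` size is M10(b)); nothing of Bałaban's analysis is asserted.

References: T. Bałaban, CMP 102 (1985) 277–309 [Balaban1985Variational] ((22)–(28) pp.281–282, Prop. 7 p.299, (141)–(143)); CMP 99 (1985) 389–434
[Balaban1985BackgroundPropagators] ((3.3)–(3.4) pp.390–391); CMP 95 (1984) 17–40 [Balaban1984PropagatorsI] (Prop. 1.1 (1.90) p.33).
-/

set_option autoImplicit false

noncomputable section

open scoped BigOperators Matrix.Norms.L2Operator Matrix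

namespace Summit.QuantumFields.YangMills.Theorems.Prop7PinnedFlatPassage

open Literature.MathematicalPhysics.QuantumFieldTheory.Balaban1983to89
open Literature.MathematicalPhysics.QuantumFieldTheory.Balaban1983to89.T3ContinuumYM3Torus
open Literature.MathematicalPhysics.QuantumFieldTheory.Balaban1983to89.T3PrintedRegularOrbits (descTransf)
open Finset B1RG242Torus BlockAveragingEMLLinearised LatticeFieldCalculus
open T4Continuum B15DeterminingSets
open B10Eq27TorusAxialLog (unitsField toUField)
open B9TorusCalculus (torusT)
open BlockAveragingEMLLinearisedBackground (pertVar)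
open Summit.QuantumFields.YangMills.Theorems.Prop7CovariantCoercivity (curl_bg_eq sum_plaq_eq_sum_ite)
open Summit.QuantumFields.YangMills.Theorems.Prop7PinnedFlatCoercivity (opNorm_sq_le_sum_normSq)
open Summit.QuantumFields.YangMills.Theorems.Prop7RelPlaqVsCovCurl (sum_hs_curl_le_relPlaq_T3)
open Summit.QuantumFields.YangMills.Theorems.Prop7PinnedSkewSplitOpt (sum_normSq_le_of_pinnedOpt_flat_T3)

section Lattice

variable (F : T3Family) {n K : ℕ} (h : n ≤ K)

/-! ## §1 The flat dictionary: plaquettes, curl, Hilbert–Schmidt sums, operator vs Frobenius mass -/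

/-- a background equal to `1` on every bond has trivial plaquette variables. [folklore] -/
theorem plaqHol_eq_one_of_bg_one (U₀ : GaugeField (F.P K) 0 (Matrix.specialUnitaryGroup (Fin 2) ℂ)) (hone : ∀ b, U₀ b = 1) (p : Plaq (F.P K) 0) :
    GaugeField.plaqHol U₀ p = 1 := by
  simp [GaugeField.plaqHol, hone]

/-- **AT `U₀ ≡ 1` THE COVARIANT CURL IS THE LATTICE CURL**: p483802's `B9Eq39Adjoint.curl` at the trivial background equals `LatticeFieldCalculus.curl 1`.
[cite: Balaban1985BackgroundPropagators, (3.3)-(3.4) pp.390-391] -/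
theorem curl_eq_curl_of_bg_one (U₀ : GaugeField (F.P K) 0 (Matrix.specialUnitaryGroup (Fin 2) ℂ)) (hone : ∀ b, U₀ b = 1)
    (Y : PBond (F.P K) 0 → Matrix (Fin 2) (Fin 2) ℂ) (p : Plaq (F.P K) 0) :
    B9Eq39Adjoint.curl (torusT (F.P K) 0) (fun κ z => unitsField (toUField U₀) ⟨z, κ⟩) (fun κ z => Y ⟨z, κ⟩) p.μ p.ν p.src = curl 1 Y p := by
  rw [curl_bg_eq U₀ Y p, hone, hone]
  simp only [curl, OneMemClass.coe_one, star_one, Matrix.one_mul, Matrix.mul_one, one_smul]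

/-- **THE HILBERT–SCHMIDT CURL SUM OF BRICK (c) AT `U₀ ≡ 1` IS THE FROBENIUS FLAT CURL ENERGY** of `Y(b) = W(b)U₀(b)^* − 1`.
[cite: Balaban1985BackgroundPropagators, (3.3)-(3.4) pp.390-391] -/
theorem hs_curl_eq_sum_normSq_curl_of_bg_one (U₀ : GaugeField (F.P K) 0 (Matrix.specialUnitaryGroup (Fin 2) ℂ)) (hone : ∀ b, U₀ b = 1)
    (W : GaugeField (F.P K) 0 (Matrix.specialUnitaryGroup (Fin 2) ℂ))
    (Y : PBond (F.P K) 0 → Matrix (Fin 2) (Fin 2) ℂ) (hY : ∀ b, Y b = (W b : Matrix (Fin 2) (Fin 2) ℂ) * star (U₀ b : Matrix (Fin 2) (Fin 2) ℂ) - 1) :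
    ∑ x : Site (F.P K) 0, ∑ μ : Fin (F.P K).d, ∑ ν : Fin (F.P K).d,
        (if μ < ν then ∑ j : Fin 2, ∑ k : Fin 2,
          ‖(B9Eq39Adjoint.curl (torusT (F.P K) 0) (fun κ z => unitsField (toUField U₀) ⟨z, κ⟩)
            (fun κ z => (W ⟨z, κ⟩ : Matrix (Fin 2) (Fin 2) ℂ) * star (U₀ ⟨z, κ⟩ : Matrix (Fin 2) (Fin 2) ℂ) - 1) μ ν x) j k‖ ^ 2 else 0)
      = ∑ p : Plaq (F.P K) 0, ∑ j : Fin 2, ∑ k : Fin 2, Complex.normSq ((curl 1 Y p) j k) := by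
  have hA : (fun κ (z : Site (F.P K) 0) => (W ⟨z, κ⟩ : Matrix (Fin 2) (Fin 2) ℂ) * star (U₀ ⟨z, κ⟩ : Matrix (Fin 2) (Fin 2) ℂ) - 1) = fun κ z => Y ⟨z, κ⟩ := by
    funext κ z
    exact (hY ⟨z, κ⟩).symm
  rw [hA, ← sum_plaq_eq_sum_ite (fun x μ ν => ∑ j : Fin 2, ∑ k : Fin 2,
    ‖(B9Eq39Adjoint.curl (torusT (F.P K) 0) (fun κ z => unitsField (toUField U₀) ⟨z, κ⟩) (fun κ z => Y ⟨z, κ⟩) μ ν x) j k‖ ^ 2)]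
  refine Finset.sum_congr rfl fun p _ => ?_
  rw [curl_eq_curl_of_bg_one F U₀ hone Y p]
  exact Finset.sum_congr rfl fun j _ => Finset.sum_congr rfl fun k _ => Complex.sq_norm _

/-- operator mass ≤ Frobenius mass, summed over the bonds. [folklore] -/
theorem sum_norm_sq_le_sum_normSq (Y : PBond (F.P K) 0 → Matrix (Fin 2) (Fin 2) ℂ) :
    ∑ b : PBond (F.P K) 0, ‖Y b‖ ^ 2 ≤ ∑ b : PBond (F.P K) 0, ∑ j : Fin 2, ∑ k : Fin 2, Complex.normSq ((Y b) j k) :=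
  Finset.sum_le_sum fun b _ => opNorm_sq_le_sum_normSq (Y b)

/-! ## §2 The (ii′)-shape for the pinned representative at the flat background -/

/-- ★★ **(ii′)-SHAPE, PINNED REPRESENTATIVE, FLAT BACKGROUND — NO CENTRE DEBIT, NO STRUCTURE ROWS** (`SU(2)`, `d = 3`, run `K`, height `n ≤ K`, `ℓ = L^{K−n}`,
`C₁ = 33600·L⁴∕(√L − 1)² + 97∕8`).  Let `W` be `ℓ²`-optimal on its pinned (4)-orbit relative to the flat background (p605285's `hopt` at `U₀ ≡ 1`), `Y(b) = W(b) − 1`,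
`‖Y(b)‖ ≤ s ≤ 1`, and let `Q^{(k)}` be any composite of the linearised average (`hQ0`, `hQs`).  Then
`(1 − s²∕2 − 24576·C₁·ℓ²·s²)·Σ_b‖Y(b)‖² ≤ 4·C₁·ℓ²·Σ_p‖W(∂p) − 1‖² + 28·ℓ·Σ_c |(Q^{(k)}Y)(c)|²_F` — at `s = ε₂ℓ⁻¹` the rate is `(1 − ε₂²∕2 − 24576C₁ε₂²)·ℓ⁻²`, k-uniform.
Proof: F5 ∘ brick (c) at `U₀ ≡ 1` (`a = 0`) ∘ §1. [cite: Balaban1985Variational, Prop. 7 p.299, (22)-(28) pp.281-282; Balaban1984PropagatorsI, Prop. 1.1 (1.90) p.33] -/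
theorem relPoincare_pinnedOpt_flat_T3 (W : GaugeField (F.P K) 0 (Matrix.specialUnitaryGroup (Fin 2) ℂ))
    (hopt : ∀ v : GaugeTransf (F.P K) 0 (Matrix.specialUnitaryGroup (Fin 2) ℂ), descTransf F n K h v = (fun _ => 1) →
      ∑ b : PBond (F.P K) 0, ‖pertVar (fun _ => 1) W b‖ ^ 2 ≤ ∑ b : PBond (F.P K) 0, ‖pertVar (fun _ => 1) (GaugeField.gaugeAct v W) b‖ ^ 2)
    (Q : (i : ℕ) → (PBond (F.P K) 0 → Matrix (Fin 2) (Fin 2) ℂ) → PBond (F.P K) i → Matrix (Fin 2) (Fin 2) ℂ)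
    (hQ0 : ∀ Y, Q 0 Y = Y)
    (hQs : ∀ (i : ℕ) (Y : PBond (F.P K) 0 → Matrix (Fin 2) (Fin 2) ℂ) (c : PBond (F.P K) (i + 1)), Q (i + 1) Y c = linAvg (Q i Y) c)
    (Y : PBond (F.P K) 0 → Matrix (Fin 2) (Fin 2) ℂ) (hY : ∀ b, Y b = (W b : Matrix (Fin 2) (Fin 2) ℂ) - 1)
    {s : ℝ} (hδ : ∀ b, ‖Y b‖ ≤ s) (hs1 : s ≤ 1) :
    (1 - s ^ 2 / 2 - 24576 * (8400 * (2 : ℝ) ^ 2 * (F.L : ℝ) ^ 4 / (Real.sqrt F.L - 1) ^ 2 + 97 / 8) * ((F.L : ℝ) ^ (K - n)) ^ 2 * s ^ 2)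
        * ∑ b : PBond (F.P K) 0, ‖Y b‖ ^ 2
      ≤ 4 * (8400 * (2 : ℝ) ^ 2 * (F.L : ℝ) ^ 4 / (Real.sqrt F.L - 1) ^ 2 + 97 / 8) * ((F.L : ℝ) ^ (K - n)) ^ 2
          * ∑ p : Plaq (F.P K) 0, ‖((GaugeField.plaqHol W p : Matrix.specialUnitaryGroup (Fin 2) ℂ) : Matrix (Fin 2) (Fin 2) ℂ) - 1‖ ^ 2
        + 28 * (F.L : ℝ) ^ (K - n) * ∑ c : PBond (F.P K) (K - n), ∑ a : Fin 2, ∑ b' : Fin 2, Complex.normSq ((Q (K - n) Y c) a b') := by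
  -- F5 first (its `hopt` is literally ours)
  have hF5 := sum_normSq_le_of_pinnedOpt_flat_T3 F h W hopt Q hQ0 hQs Y hY hδ
  have hC₁0 : (0 : ℝ) ≤ 8400 * (2 : ℝ) ^ 2 * (F.L : ℝ) ^ 4 / (Real.sqrt F.L - 1) ^ 2 + 97 / 8 := by positivity
  have hℓ0 : (0 : ℝ) ≤ (F.L : ℝ) ^ (K - n) := by positivity
  -- letters
  set C₁ : ℝ := 8400 * (2 : ℝ) ^ 2 * (F.L : ℝ) ^ 4 / (Real.sqrt F.L - 1) ^ 2 + 97 / 8 with hC₁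
  set ℓ : ℝ := (F.L : ℝ) ^ (K - n) with hℓ
  set MF : ℝ := ∑ b : PBond (F.P K) 0, ∑ a : Fin 2, ∑ b' : Fin 2, Complex.normSq ((Y b) a b') with hMF
  set MO : ℝ := ∑ b : PBond (F.P K) 0, ‖Y b‖ ^ 2 with hMO
  set CURL : ℝ := ∑ p : Plaq (F.P K) 0, ∑ a : Fin 2, ∑ b' : Fin 2, Complex.normSq ((curl 1 Y p) a b') with hCURL
  set AVG : ℝ := ∑ c : PBond (F.P K) (K - n), ∑ a : Fin 2, ∑ b' : Fin 2, Complex.normSq ((Q (K - n) Y c) a b') with hAVG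
  set RP : ℝ := ∑ p : Plaq (F.P K) 0, ‖((GaugeField.plaqHol W p : Matrix.specialUnitaryGroup (Fin 2) ℂ) : Matrix (Fin 2) (Fin 2) ℂ) - 1‖ ^ 2 with hRP
  -- the flat background as a field
  set U₀ : GaugeField (F.P K) 0 (Matrix.specialUnitaryGroup (Fin 2) ℂ) := fun _ => 1 with hU₀
  have hone : ∀ b : PBond (F.P K) 0, U₀ b = 1 := fun b => by rw [hU₀]
  have hY' : ∀ b : PBond (F.P K) 0, Y b = (W b : Matrix (Fin 2) (Fin 2) ℂ) * star (U₀ b : Matrix (Fin 2) (Fin 2) ℂ) - 1 := fun b => by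
    rw [hone b, hY b]
    simp only [OneMemClass.coe_one, star_one, Matrix.mul_one]
  -- brick (c) at `U₀`, `ε = 0`
  have hbg : ∀ p : Plaq (F.P K) 0, dist1 (GaugeField.plaqHol U₀ p) ≤ 0 * (((F.L : ℝ) ^ (K - n)) ^ 2)⁻¹ := fun p => by
    rw [plaqHol_eq_one_of_bg_one F U₀ hone p, GaugeGroup.dist1_one, zero_mul]
  have hδ' : ∀ b : PBond (F.P K) 0, ‖(W b : Matrix (Fin 2) (Fin 2) ℂ) * star (U₀ b : Matrix (Fin 2) (Fin 2) ℂ) - 1‖ ≤ s := fun b => by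
    rw [← hY' b]; exact hδ b
  have hc := sum_hs_curl_le_relPlaq_T3 F n K W U₀ hbg hδ' hs1
  rw [hs_curl_eq_sum_normSq_curl_of_bg_one F U₀ hone W Y hY'] at hc
  have hRP1 : ∑ p : Plaq (F.P K) 0, ‖((GaugeField.plaqHol W p : Matrix.specialUnitaryGroup (Fin 2) ℂ) : Matrix (Fin 2) (Fin 2) ℂ)
        * star ((GaugeField.plaqHol U₀ p : Matrix.specialUnitaryGroup (Fin 2) ℂ) : Matrix (Fin 2) (Fin 2) ℂ) - 1‖ ^ 2 = RP := by
    refine Finset.sum_congr rfl fun p _ => ?_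
    rw [plaqHol_eq_one_of_bg_one F U₀ hone p]
    simp only [OneMemClass.coe_one, star_one, Matrix.mul_one]
  have hMO' : ∑ b : PBond (F.P K) 0, ‖(W b : Matrix (Fin 2) (Fin 2) ℂ) * star (U₀ b : Matrix (Fin 2) (Fin 2) ℂ) - 1‖ ^ 2 = MO :=
    Finset.sum_congr rfl fun b _ => by rw [← hY' b]
  rw [hRP1, hMO'] at hc
  have hc' : CURL ≤ 4 * RP + 24576 * s ^ 2 * MO := by
    have e : (24576 * s ^ 2 + 768 * (0 * (((F.L : ℝ) ^ (K - n)) ^ 2)⁻¹) ^ 2) = 24576 * s ^ 2 := by ring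
    rw [e] at hc
    exact hc
  -- operator mass ≤ Frobenius mass; `0 ≤ 1 − s²/2`
  have hMOF : MO ≤ MF := sum_norm_sq_le_sum_normSq F Y
  have hs2 : s ^ 2 ≤ 1 := by
    have hs0 : 0 ≤ s := by
      have b : PBond (F.P K) 0 := ⟨default, ⟨0, by rw [T3Family.P_d]; norm_num⟩⟩
      exact (norm_nonneg _).trans (hδ b)
    nlinarith
  have hfac : 0 ≤ 1 - s ^ 2 / 2 := by linarith
  have h1 : (1 - s ^ 2 / 2) * MO ≤ C₁ * ℓ ^ 2 * CURL + 28 * ℓ * AVG := (mul_le_mul_of_nonneg_left hMOF hfac).trans hF5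
  have h2 : C₁ * ℓ ^ 2 * CURL ≤ C₁ * ℓ ^ 2 * (4 * RP + 24576 * s ^ 2 * MO) := mul_le_mul_of_nonneg_left hc' (mul_nonneg hC₁0 (pow_nonneg hℓ0 2))
  linarith [h1, h2]

end Lattice

end Summit.QuantumFields.YangMills.Theorems.Prop7PinnedFlatPassage

end
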